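import Summits.SmoothPoincare4.SmoothPoincare4.Theorems.EntropyRungConicalGapStubTransformFinite
import HarnessLib

/-!
# Stub `helper_transformFinite_iterated` of line `Sketch` (crux `EntropyRung.ConicalGap`, stmt-SmoothPoincare4-16589)

Wang–Wang 2023 (arXiv:2308.06560, proof of Prop. 2.6, (2.7)–(2.10)), the finite-`T` density
transform in ITERATED form, i.e. with the scale integral outside. In the setting of
`stub_transformFinite` (σ-finite Borel measure `μ`, continuous `f, R ≥ 0`, the three weights
`e^{-f/τ}, f e^{-f/τ}, R e^{-f/τ}` integrable for every `τ > 0`, and the weighted identity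
`∫ (f − 2τ) e^{-f/τ} dμ = (1 − τ) ∫ R e^{-f/τ} dμ` for every `τ > 0`) one has for every `T ≥ 1`

  `∫ e^{-f} dμ = T⁻² ∫ e^{-f/T} dμ + ∫₁^T (τ − 1) τ⁻⁴ (∫ R e^{-f/τ} dμ) dτ`.

Proof: `stub_transformFinite` gives the same identity with the kernel integral inside,
`∫ R(x) (∫₁^T (τ − 1) τ⁻⁴ e^{-f(x)/τ} dτ) dμ(x)`; the Fubini lemma `transformFinite_swapG`
(domination by `T R e^{-f/T}` on `X × (1, T]`) swaps the two integrals, and the scalar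
`(τ − 1) τ⁻⁴` is pulled out of the inner integral.

Everything here is proved from Mathlib and the landed stub file; no definition and no named fact
is introduced.

## References

* Y. Wang, G. Wang (Wang–Wang 2023), arXiv:2308.06560, Prop. 2.6, (2.7)–(2.10).
-/

noncomputable section

-- `Summit.SmoothPoincare4.SmoothPoincare4.…` (summit = problem) trips `dupNamespace` on every decl.
set_option linter.dupNamespace false

open MeasureTheory Set Filter

namespace Summit.SmoothPoincare4.SmoothPoincare4.Theorems.ConicalGapSketch

/-! ## Reshaping the two iterated integrals -/

/-- Pointwise kernel: `∫_{(1,T]} τ⁻⁴ (1 − τ) R e^{-t/τ} dτ = −(R ∫₁^T (τ − 1) τ⁻⁴ e^{-t/τ} dτ)`. -/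
theorem transformIterated_inner (c t : ℝ) {T : ℝ} (hT : 1 ≤ T) :
    ∫ τ in Ioc 1 T, (τ ^ 4)⁻¹ * ((1 - τ) * (c * Real.exp (-t / τ))) =
      -(c * ∫ τ in (1 : ℝ)..T, (τ - 1) / τ ^ 4 * Real.exp (-t / τ)) := by
  rw [intervalIntegral.integral_of_le hT, ← integral_const_mul, ← integral_neg]
  refine integral_congr_ae (Eventually.of_forall fun τ ↦ ?_)
  beta_reduce
  ring

/-- Outer form: `∫_{(1,T]} (∫ τ⁻⁴ (1 − τ) R e^{-f/τ} dμ) dτ = −∫₁^T (τ − 1) τ⁻⁴ (∫ R e^{-f/τ} dμ) dτ`.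
-/
theorem transformIterated_outer {X : Type*} [MeasurableSpace X] (μ : Measure X) (f R : X → ℝ)
    {T : ℝ} (hT : 1 ≤ T) :
    ∫ τ in Ioc 1 T, ∫ x, (τ ^ 4)⁻¹ * ((1 - τ) * (R x * Real.exp (-f x / τ))) ∂μ =
      -∫ τ in (1 : ℝ)..T, (τ - 1) / τ ^ 4 * ∫ x, R x * Real.exp (-f x / τ) ∂μ := by
  rw [intervalIntegral.integral_of_le hT, ← integral_neg]
  refine integral_congr_ae (Eventually.of_forall fun τ ↦ ?_)
  beta_reduce
  rw [← integral_const_mul, ← integral_neg]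
  refine integral_congr_ae (Eventually.of_forall fun x ↦ ?_)
  beta_reduce
  ring

/-! ## The registered stub -/

/-- **Stub `helper_transformFinite_iterated` of line `Sketch`** (Wang–Wang 2023,
arXiv:2308.06560, (2.7)–(2.10), finite `T`, iterated form): for a σ-finite Borel measure `μ`,
continuous `f, R ≥ 0` whose three weights `e^{-f/τ}, f e^{-f/τ}, R e^{-f/τ}` are integrable for
every `τ > 0` and which satisfy the weighted identity
`∫ (f − 2τ) e^{-f/τ} dμ = (1 − τ) ∫ R e^{-f/τ} dμ` for every `τ > 0`, one has for every `T ≥ 1`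
`∫ e^{-f} dμ = T⁻² ∫ e^{-f/T} dμ + ∫₁^T (τ − 1) τ⁻⁴ (∫ R e^{-f/τ} dμ) dτ`. -/
theorem helper_transformFinite_iterated : ∀ (X : Type) [TopologicalSpace X] [SecondCountableTopology X] [MeasurableSpace X] [BorelSpace X] (μ : MeasureTheory.Measure X) [MeasureTheory.SigmaFinite μ] (f R : X → ℝ), Continuous f → Continuous R → (∀ x, 0 ≤ f x) → (∀ x, 0 ≤ R x) → (∀ τ : ℝ, 0 < τ → MeasureTheory.Integrable (fun x ↦ Real.exp (-f x / τ)) μ ∧ MeasureTheory.Integrable (fun x ↦ f x * Real.exp (-f x / τ)) μ ∧ MeasureTheory.Integrable (fun x ↦ R x * Real.exp (-f x / τ)) μ) → (∀ τ : ℝ, 0 < τ → ∫ x, (f x - 2 * τ) * Real.exp (-f x / τ) ∂μ = (1 - τ) * ∫ x, R x * Real.exp (-f x / τ) ∂μ) → ∀ T : ℝ, 1 ≤ T → ∫ x, Real.exp (-f x) ∂μ = (T ^ 2)⁻¹ * (∫ x, Real.exp (-f x / T) ∂μ) + ∫ τ in (1 : ℝ)..T, (τ - 1) / τ ^ 4 *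 ∫ x, R x * Real.exp (-f x / τ) ∂μ := by
  intro X _ _ _ _ μ _ f R hf hR hf0 hR0 hint hid T hT
  have hT0 : 0 < T := one_pos.trans_le hT
  obtain ⟨-, -, hCT⟩ := hint T hT0
  -- Fubini for `τ⁻⁴ (1 − τ) R e^{-f/τ}` on `X × (1, T]`
  obtain ⟨-, hGswap⟩ := transformFinite_swapG μ hf.measurable hR.measurable hf0 hR0 hCT
  -- the transform with the kernel integral inside
  obtain ⟨-, hZ⟩ := stub_transformFinite X μ f R hf hR hf0 hR0 hint hid T hT
  have e4 : ∫ x, (∫ τ in Ioc 1 T, (τ ^ 4)⁻¹ * ((1 - τ) * (R x * Real.exp (-f x / τ)))) ∂μ =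
      -∫ x, R x * (∫ τ in (1 : ℝ)..T, (τ - 1) / τ ^ 4 * Real.exp (-f x / τ)) ∂μ := by
    rw [← integral_neg]
    exact integral_congr_ae (Eventually.of_forall fun x ↦ transformIterated_inner (R x) (f x) hT)
  have key : ∫ x, R x * (∫ τ in (1 : ℝ)..T, (τ - 1) / τ ^ 4 * Real.exp (-f x / τ)) ∂μ =
      ∫ τ in (1 : ℝ)..T, (τ - 1) / τ ^ 4 * ∫ x, R x * Real.exp (-f x / τ) ∂μ := by
    have h := hGswap
    rw [e4, transformIterated_outer μ f R hT] at h
    linarith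
  rw [hZ, key]

end Summit.SmoothPoincare4.SmoothPoincare4.Theorems.ConicalGapSketch

end
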